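import Mathlib
import HarnessLib
import Summits.HubbardSuperconductivity.HubbardSuperconductivity.Theorems.KLProgrammeC4aUmkDirectTangencyLayers
import Summits.HubbardSuperconductivity.HubbardSuperconductivity.Theorems.KLProgrammeC4aUmkDirectCooperLayers
import Summits.HubbardSuperconductivity.HubbardSuperconductivity.Theorems.KLProgrammeC4aUmkCutoffDefs
import Summits.HubbardSuperconductivity.HubbardSuperconductivity.Theorems.KLProgrammeC4aUmkNumerator

/-!
# Route `KLProgramme` — crux C4a, S3 brick (B4) «(U1)-HYBRID» B-1 (vi): THE FIRST-ORDER LAYER, SUMMED — umklapp (U7, as two integrated hypotheses) + tangency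
# (B-1 (iii)) + Cooper (B-1 (iv)) after the hybrid split by the cut-offs of B-1 (v): `∫_{(0,2π]} |∫_{−hi}^{hi} wt(e) ∫_{−π}^{π} J·G·(K e)′(ē) dv de| dϑ ≤ U + Λ_T·L + Λ_C·L`

Cell `gate-hubbard-kl`, seat hubbard-kl-k3c3-p3 (g37; row «implicit-function / monotonicity route for μ(n)»).  Located brick for the (C)-closer lane / the `M₁`
assembly (stub (C) `stub_twoLeg_curvature` of `KLRegimeEngineV17F2`, stmt-HubbardSuperconductivity-20437), memo HOME/hubbard-kl-k3c3-p3/U1-CAUSTIC-SUP.md §19–§20 (B-1),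
the `M₁` call graph (a)+(b)+(c)+(e).

LOCATED (g37): D-2c's loop-angle localisation row with a single window (`Wϑ = W`) is infeasible (`π·msD₁/(4u_min) > 1` for the tree's size table); the primed
forms `directTangency_levelLine_abs_le'` / `directTangency_layers_abs_le'` with a separate relative-angle window `Wϑ ≤ W` are used here.

WHY.  The first-order co-moving jet of the tube pp bubble on the level box is `∫de wt(e) ∫dv J(e,v)·G(ϑ,e,v)·(K e)′(ē)` (absolute loop angle; (B3) + `…C4aUmkCurrencyIdentity`),
`G = De_K(S(ϑ) − Φ(e,v+θ))[S′(ϑ)]`.  With the cut-offs `c_d = umkDirCut μ K ρ θ τ₂`, `c_C = umkCooperCut μ K ρ θ s₂` (B-1 (v)) the numerator splits as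
`J·G = c_d c_C·J·G + (1 − c_d)·J·G + c_d(1 − c_C)·J·G` (`umk_split`).  The umklapp piece is the numerator of `…C4aUmkNumerator` / U7 (`umkLoopCircle_integral[_middle]_le_canonical`,
run by the kernel side over its kernel pieces); its integrated bound enters here as the HYPOTHESIS `hUmk` (in U7's currency: `∫_{0}^{2π} |∫_{−hi}^{hi}∫_{−π}^{π} wt·(Y·(K e)′(ē))|`).
The tangency piece is `…C4aUmkDirectTangencyLayers.directTangency_layers_abs_le` with `c = 1 − c_d` (support row `umkDirCut_eq_one`), the Cooper piece
`…C4aUmkDirectCooperLayers.directCooper_layers_abs_le` with `c = c_d(1 − c_C)` (support row `umkCooperCut_eq_one`), both with `B_c = 24msD₁/τ₂` (`abs_deriv_umkDirCut_le`).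
The three box integrals are continuous in `ϑ` (`…C4aBoxIntegralContinuityCfg` with `…C4aUmkNumerator.umkNumerator_continuousOn₃`), the loop and level integrals split by
continuity (`continuousOn_level_lineIntegral`), and the `ϑ` integral of the absolute value is sub-additive.
* `continuousOn_level_lineIntegral` — `e ↦ ∫_{−π}^{π} X(ϑ,e,v)·(K e)′(ē) dv` is continuous on `[−hi, hi]`;
* **`firstOrderLayer_abs_le`** (HEADLINE): `∫_{(0,2π]} |∫_{−hi}^{hi} wt ∫_{−π}^{π} J·G·(K e)′(ē)| ≤ U + Λ_T·L + Λ_C·L`, `L = 2·2π(K_d + P(1 + log⁺(M/π))) + 8π²W_t`.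
What is NOT here: the identification of `wt`, `J`, `K e` with the model's level profile / rotated Jacobian / partner propagator of the (B3) representation (the (C)-closer's bridge
to `CoMovingJetsL1Theta`'s `i = 1` row), and the kernel side's discharge of `hUmk` (k3c3-p1's FarS/MidS one-calls over U7).
Sizes binder shape + `FrameOK` + `GeomConstants`; nothing asserts (C), K3 or superconductivity.
References: FST II CPAM 51 (1998) §3 Thm 3.5 [cite: FeldmanSalmhoferTrubowitz1998]; BGM 2006 §2.4 (2.36)/(2.40) [cite: BenfattoGiulianiMastropietro2006]; Salmhofer 1999 §4.5.3
[cite: Salmhofer1999].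
-/

noncomputable section

namespace Summit.HubbardSuperconductivity.HubbardSuperconductivity.Theorems.C4a

set_option linter.dupNamespace false -- summit = problem name (single-conjunct summit), D-0017

open Real Set Filter MeasureTheory intervalIntegral
open scoped Topology
open Literature.MathematicalPhysics.QuantumLattice Literature.MathematicalPhysics.QuantumLattice.BandSectorCounting Literature.Probability.LatticeModels
open Literature.MathematicalPhysics.QuantumLattice.FermiRG
open Summit.HubbardSuperconductivity.HubbardSuperconductivity.Theorems.KLRegimeSplit
open Summit.HubbardSuperconductivity.HubbardSuperconductivity.Theorems.DispersionFlow
open Summit.HubbardSuperconductivity.HubbardSuperconductivity.Theorems.PerturbedFermiCurve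

section Sizes

variable {K : TrigPolyC4v} {A : ℝ} (hA : ∀ p : Momentum, ∀ j ≤ 2, ‖iteratedFDeriv ℝ j (frameShift K) p‖ ≤ A) (hA20 : A ≤ 1 / 20)
  (hd : klCurveD ≤ (bandBounds (show (-4 : ℝ) < -1.1 by norm_num) (show (-1.1 : ℝ) ≤ -0.1 by norm_num) (show (-0.1 : ℝ) < 0 by norm_num)).Dtmin - 2 * A)
  {μ r : ℝ} (hr : 0 < r) (hlo : (-1.1 : ℝ) < μ - r - A) (hhi : μ + r + A < -0.1)
  {A₃ A₄ A₅ A₆ : ℝ} (hA₃ : ∀ p : Momentum, ‖iteratedFDeriv ℝ 3 (frameShift K) p‖ ≤ A₃)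
  (hA₄ : ∀ p : Momentum, ‖iteratedFDeriv ℝ 4 (frameShift K) p‖ ≤ A₄)
  (hA₅ : ∀ p : Momentum, ‖iteratedFDeriv ℝ 5 (frameShift K) p‖ ≤ A₅)
  (hA₆ : ∀ p : Momentum, ‖iteratedFDeriv ℝ 6 (frameShift K) p‖ ≤ A₆)
  {K₁ K₂ K₃ : ℝ} (hK₁ : ∀ p : Momentum, ‖fderiv ℝ (frameLevel μ K) p‖ ≤ K₁) (hK₂ : ∀ p : Momentum, ‖iteratedFDeriv ℝ 2 (frameLevel μ K) p‖ ≤ K₂)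
  (hK₃ : ∀ p : Momentum, ‖iteratedFDeriv ℝ 3 (frameLevel μ K) p‖ ≤ K₃)
include hA hA20 hd hr hlo hhi hA₃ hA₄ hA₅ hA₆ hK₁ hK₂ hK₃

omit hA20 hr hA₃ hA₄ hA₅ hA₆ hK₁ hK₂ hK₃ in
/-- **A loop line integral with a jointly continuous integrand is continuous in the loop level on `[−hi, hi]`** (`0 ≤ hi < r`): for `X(ϑ,·,·)` continuous on
`[−hi,hi] × ℝ` and `∂ᵤK` jointly continuous, `e ↦ ∫_{−π}^{π} X(ϑ,e,v)·(K e)′(e_K(S − Φ(e,v+θ))) dv` is continuous on `[−hi, hi]`. -/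
theorem continuousOn_level_lineIntegral {ρ : ℝ} (ϑ θ : ℝ) {hi : ℝ} (hhi0 : 0 ≤ hi) (hhir : hi < r) {X : ℝ → ℝ → ℝ → ℝ} {Kr : ℝ → ℝ → ℝ}
    (hX2 : ContinuousOn (fun p : ℝ × ℝ => X ϑ p.1 p.2) (Icc (-hi) hi ×ˢ univ)) (hKc : Continuous fun p : ℝ × ℝ => deriv (Kr p.1) p.2) :
    ContinuousOn (fun e : ℝ => ∫ v in (-π)..π, X ϑ e v * deriv (Kr e) (frameLevel μ K (pairSumPath μ K ρ ϑ θ 0 - levelPoint μ K e (v + θ)))) (Icc (-hi) hi) := by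
  set B := bandBounds (show (-4 : ℝ) < -1.1 by norm_num) (show (-1.1 : ℝ) ≤ -0.1 by norm_num) (show (-0.1 : ℝ) < 0 by norm_num) with hBdef
  have hADt : 2 * A < B.Dtmin := by have := klCurveD_pos; linarith only [this, hd]
  have hlev : ContinuousOn (fun p : ℝ × ℝ => levelPoint μ K p.1 p.2) ({x : ℝ | |x| < r} ×ˢ univ) :=
    (contDiffOn_levelPoint B hA hADt hlo hhi (m := 0)).continuousOn
  have hfl : Continuous (frameLevel μ K) := (EngineV8.contDiff_frameLevel μ K (n := 0)).continuous
  have hhh : -hi ≤ hi := by linarith only [hhi0]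
  have hcl : Continuous fun p : ℝ × ℝ => max (-hi) (min p.1 hi) := continuous_const.max ((continuous_fst).min continuous_const)
  have hclI : ∀ p : ℝ × ℝ, max (-hi) (min p.1 hi) ∈ Icc (-hi) hi := fun p => ⟨le_max_left _ _, max_le hhh (min_le_right _ _)⟩
  have hclr : ∀ p : ℝ × ℝ, |max (-hi) (min p.1 hi)| < r := fun p =>
    abs_lt.2 ⟨by linarith only [(hclI p).1, hhir], lt_of_le_of_lt (hclI p).2 hhir⟩
  have hL := hlev.comp_continuous (f := fun p : ℝ × ℝ => ((max (-hi) (min p.1 hi), p.2 + θ) : ℝ × ℝ))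
    (hcl.prodMk (continuous_snd.add continuous_const)) fun p => mem_prod.2 ⟨hclr p, mem_univ _⟩
  have hL' : Continuous fun p : ℝ × ℝ => levelPoint μ K (max (-hi) (min p.1 hi)) (p.2 + θ) := hL.congr fun _ => rfl
  have hband : Continuous fun p : ℝ × ℝ => frameLevel μ K (pairSumPath μ K ρ ϑ θ 0 - levelPoint μ K (max (-hi) (min p.1 hi)) (p.2 + θ)) :=
    hfl.comp (continuous_const.sub hL')
  have hK := hKc.comp (hcl.prodMk hband)
  have hK' : Continuous fun p : ℝ × ℝ => deriv (Kr (max (-hi) (min p.1 hi)))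
      (frameLevel μ K (pairSumPath μ K ρ ϑ θ 0 - levelPoint μ K (max (-hi) (min p.1 hi)) (p.2 + θ))) := hK.congr fun _ => rfl
  have hXc := hX2.comp_continuous (f := fun p : ℝ × ℝ => ((max (-hi) (min p.1 hi), p.2) : ℝ × ℝ)) (hcl.prodMk continuous_snd)
    fun p => mem_prod.2 ⟨hclI p, mem_univ _⟩
  have hXc' : Continuous fun p : ℝ × ℝ => X ϑ (max (-hi) (min p.1 hi)) p.2 := hXc.congr fun _ => rfl
  have hj : Continuous fun p : ℝ × ℝ => X ϑ (max (-hi) (min p.1 hi)) p.2 * deriv (Kr (max (-hi) (min p.1 hi)))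
      (frameLevel μ K (pairSumPath μ K ρ ϑ θ 0 - levelPoint μ K (max (-hi) (min p.1 hi)) (p.2 + θ))) := hXc'.mul hK'
  have hI : Continuous fun e : ℝ => ∫ v in (-π)..π, X ϑ (max (-hi) (min e hi)) v * deriv (Kr (max (-hi) (min e hi)))
      (frameLevel μ K (pairSumPath μ K ρ ϑ θ 0 - levelPoint μ K (max (-hi) (min e hi)) (v + θ))) :=
    intervalIntegral.continuous_parametric_intervalIntegral_of_continuous' (f := fun e v => X ϑ (max (-hi) (min e hi)) v *
      deriv (Kr (max (-hi) (min e hi))) (frameLevel μ K (pairSumPath μ K ρ ϑ θ 0 - levelPoint μ K (max (-hi) (min e hi)) (v + θ)))) hj (-π) π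
  refine (hI.continuousOn (s := Icc (-hi) hi)).congr fun e he => ?_
  simp only [min_eq_left he.2, max_eq_right he.1]
set_option maxHeartbeats 400000 in
/-- **THE FIRST-ORDER LAYER, SUMMED** (HEADLINE; see the module docstring). [cite: FeldmanSalmhoferTrubowitz1998, §3 Thm 3.5] -/
theorem firstOrderLayer_abs_le {R : RenConsts} {U : ℝ} {N : ℕ} (hF : FrameOK R U N μ K) {Kc r₀ g₀ w : ℝ} (hG : GeomConstants (frameLevel μ K) Kc r₀ g₀ w)
    {W K₀ : ℝ}
    (hW : W * (2 * K₃ * msD A₃ A₄ 1 ^ 3 + 4 * K₂ * msD A₃ A₄ 1 * msD A₃ A₄ 2 + K₁ * msD A₃ A₄ 3) ≤ 3 / 200 * (bandBounds (show (-4 : ℝ) < -1.1 by norm_num) (show (-1.1 : ℝ) ≤ -0.1 by norm_num) (show (-0.1 : ℝ) < 0 by norm_num)).umin ^ 2)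
    (hK₀ : ∀ p : Momentum, |frameLevel μ K p| ≤ K₀)
    {ρ : ℝ} (hρ : |ρ| < r) (θ : ℝ) {κ τ₂ Wϑ : ℝ} (hκ0 : 0 < κ) (hκ : κ ≤ (-μ - A - |ρ|) / (6 * π ^ 2) - A / 8 - A ^ 2 / (4 * (-μ - A - |ρ|)))
    (hWϑ0 : 0 ≤ Wϑ) (hWϑ : Wϑ ≤ W)
    (hmargin : (|ρ| / 2 + ρ ^ 2 / (4 * (-μ - A - |ρ|)) + Kc * τ₂ / 2) / κ < (2 * (bandBounds (show (-4 : ℝ) < -1.1 by norm_num) (show (-1.1 : ℝ) ≤ -0.1 by norm_num) (show (-0.1 : ℝ) < 0 by norm_num)).umin / π * Wϑ) ^ 2)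
    (hvW : π / (4 * (bandBounds (show (-4 : ℝ) < -1.1 by norm_num) (show (-1.1 : ℝ) ≤ -0.1 by norm_num) (show (-0.1 : ℝ) < 0 by norm_num)).umin) * (|ρ| / ((bandBounds (show (-4 : ℝ) < -1.1 by norm_num) (show (-1.1 : ℝ) ≤ -0.1 by norm_num) (show (-0.1 : ℝ) < 0 by norm_num)).Dtmin - 2 * A) + msD A₃ A₄ 1 * Wϑ + τ₂) ≤ W)
    {δ₀ η₀ s₂ : ℝ} (hδ₀ : 0 < δ₀) (hδ₀π : δ₀ ≤ π / 2)
    (hδrow : (K₃ * msD A₃ A₄ 1 ^ 2 + K₂ * msD A₃ A₄ 2) * msD A₃ A₄ 1 * δ₀ ≤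
      (2 / π * (((bandBounds (show (-4 : ℝ) < -1.1 by norm_num) (show (-1.1 : ℝ) ≤ -0.1 by norm_num) (show (-0.1 : ℝ) < 0 by norm_num)).Dtmin - 2 * A) *
        (bandBounds (show (-4 : ℝ) < -1.1 by norm_num) (show (-1.1 : ℝ) ≤ -0.1 by norm_num) (show (-0.1 : ℝ) < 0 by norm_num)).umin) *
        ((bandBounds (show (-4 : ℝ) < -1.1 by norm_num) (show (-1.1 : ℝ) ≤ -0.1 by norm_num) (show (-0.1 : ℝ) < 0 by norm_num)).umin * w / (4 + 2 * A))) / 2)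
    (hη₀ : η₀ ≤ δ₀ / 2)
    (hη₀row : (K₁ * msD A₃ A₄ 2 + K₂ * msD A₃ A₄ 1 ^ 2) * η₀ ≤
      (2 / π * (((bandBounds (show (-4 : ℝ) < -1.1 by norm_num) (show (-1.1 : ℝ) ≤ -0.1 by norm_num) (show (-0.1 : ℝ) < 0 by norm_num)).Dtmin - 2 * A) *
        (bandBounds (show (-4 : ℝ) < -1.1 by norm_num) (show (-1.1 : ℝ) ≤ -0.1 by norm_num) (show (-0.1 : ℝ) < 0 by norm_num)).umin) *
        ((bandBounds (show (-4 : ℝ) < -1.1 by norm_num) (show (-1.1 : ℝ) ≤ -0.1 by norm_num) (show (-0.1 : ℝ) < 0 by norm_num)).umin * w / (4 + 2 * A))) * δ₀ / 4)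
    (hs₂η : π / (2 * (bandBounds (show (-4 : ℝ) < -1.1 by norm_num) (show (-1.1 : ℝ) ≤ -0.1 by norm_num) (show (-0.1 : ℝ) < 0 by norm_num)).umin) * s₂ ≤ η₀)
    {hi₀ Kd P M lo hi Wt : ℝ} (hP : 0 ≤ P) (hWt : 0 ≤ Wt)
    (hdom : ∀ (hi ρ θ lo : ℝ) (t wt : ℝ → ℝ), 0 < hi → hi ≤ hi₀ → |ρ| < r → 0 < lo → lo ≤ hi → (∀ e ∈ Icc lo hi, e ≤ t e) →
      (∀ e ∈ Icc lo hi, 0 ≤ wt e) → (∀ e ∈ Icc lo hi, wt e ≤ Wt) → ∀ ϑ : ℝ, 0 < FermiRG.torusDist (ϑ - π) →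
        (∫ e in lo..hi, wt e * ∫ x in Icc (-π) π, (max (t e) |frameLevel μ K (pairSumPath μ K ρ ϑ θ 0 - levelPoint μ K e (x + θ))|)⁻¹) ≤
            Kd + P * log⁺ (M / FermiRG.torusDist (ϑ - π)) ∧
          (∫ e in lo..hi, wt e * ∫ x in Icc (-π) π, (max (t e) |frameLevel μ K (pairSumPath μ K ρ ϑ θ 0 - levelPoint μ K (-e) (x + θ))|)⁻¹) ≤
            Kd + P * log⁺ (M / FermiRG.torusDist (ϑ - π)))
    (hlo0 : 0 < lo) (hlohi : lo ≤ hi) (hhi₀ : hi ≤ hi₀) (hhir : hi < r) {wt : ℝ → ℝ}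
    (hwc : ContinuousOn wt (Icc (-hi) hi)) (hw0 : ∀ e ∈ Icc (-hi) hi, 0 ≤ wt e) (hwW : ∀ e ∈ Icc (-hi) hi, wt e ≤ Wt)
    (hτ₂ : 0 < τ₂) (hs₂ : 0 < s₂)
    {Jw : ℝ → ℝ → ℝ} {Kr : ℝ → ℝ → ℝ} {J₀ J₁ U : ℝ}
    (hJ : ∀ e ∈ Icc (-hi) hi, ContDiff ℝ 1 (Jw e)) (hJb : ∀ e ∈ Icc (-hi) hi, ∀ v, |Jw e v| ≤ J₀) (hJ1 : ∀ e ∈ Icc (-hi) hi, ∀ v, |deriv (Jw e) v| ≤ J₁)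
    (hJper : ∀ e ∈ Icc (-hi) hi, ∀ v, Jw e (v + 2 * π) = Jw e v) (hJ2 : ContinuousOn (fun q : ℝ × ℝ => Jw q.1 q.2) (Icc (-hi) hi ×ˢ univ))
    (hKd : ∀ e ∈ Icc (-hi) hi, ContDiff ℝ 1 (Kr e)) (hKc : Continuous fun p : ℝ × ℝ => deriv (Kr p.1) p.2)
    (hK0 : ∀ e ∈ Icc (-hi) hi, e ≠ 0 → ∀ u, |Kr e u| ≤ (max |e| |u|)⁻¹) (hK0s : ∀ e ∈ Icc (-lo) lo, ∀ u, |Kr e u| ≤ (max lo |u|)⁻¹)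
    (hK1 : ∀ e ∈ Icc (-hi) hi, e ≠ 0 → ∀ u, |deriv (Kr e) u| ≤ (max |e| |u|)⁻¹ ^ 2)
    (hKs1 : ∀ e ∈ Icc (-lo) lo, ∀ u, |deriv (Kr e) u| ≤ (max lo |u|)⁻¹ ^ 2)
    (hUmk : ∫ ϑ in (0 : ℝ)..(2 * π), |∫ e in (-hi)..hi, ∫ v in (-π)..π, wt e *
      (umkDirCut μ K ρ θ τ₂ ϑ v * umkCooperCut μ K ρ θ s₂ ϑ * Jw e v * ((fderiv ℝ (frameLevel μ K) (pairSumPath μ K ρ ϑ θ 0 - levelPoint μ K e (v + θ)))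
          (iteratedDeriv 1 (levelPoint μ K 0) θ + iteratedDeriv 1 (levelPoint μ K ρ) (ϑ + θ))) * deriv (Kr e) (frameLevel μ K (pairSumPath μ K ρ ϑ θ 0 - levelPoint μ K e (v + θ))))| ≤ U) :
    ∫ ϑ in Ioc 0 (2 * π), |∫ e in (-hi)..hi, wt e * ∫ v in (-π)..π,
        Jw e v * ((fderiv ℝ (frameLevel μ K) (pairSumPath μ K ρ ϑ θ 0 - levelPoint μ K e (v + θ)))
          (iteratedDeriv 1 (levelPoint μ K 0) θ + iteratedDeriv 1 (levelPoint μ K ρ) (ϑ + θ))) * deriv (Kr e) (frameLevel μ K (pairSumPath μ K ρ ϑ θ 0 - levelPoint μ K e (v + θ)))| ≤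
      U + (J₀ * ((6 * (max (max K₀ K₁) (max K₂ K₃)) * (max 1 (max (4 * msD A₃ A₄ 1) (max (6 * msD A₃ A₄ 2) (10 * msD A₃ A₄ 3)))) ^ 3) / (2 * (3 / 400 * (bandBounds (show (-4 : ℝ) < -1.1 by norm_num) (show (-1.1 : ℝ) ≤ -0.1 by norm_num) (show (-0.1 : ℝ) < 0 by norm_num)).umin ^ 2)) + ((6 * (max (max K₀ K₁) (max K₂ K₃)) * (max 1 (max (4 * msD A₃ A₄ 1) (max (6 * msD A₃ A₄ 2) (10 * msD A₃ A₄ 3)))) ^ 3) / (2 * (3 / 400 * (bandBounds (show (-4 : ℝ) < -1.1 by norm_num) (show (-1.1 : ℝ) ≤ -0.1 by norm_num) (show (-0.1 : ℝ) < 0 by norm_num)).umin ^ 2)) * ((max (max K₀ K₁) (max K₂ K₃)) * max (1 / ((bandBounds (show (-4 : ℝ) < -1.1 by norm_num) (show (-1.1 : ℝ) ≤ -0.1 by norm_num) (show (-0.1 : ℝ) < 0 by norm_num)).Dtmin - 2 * A)) (radialRowOneConst A ((bandBounds (show (-4 : ℝ) < -1.1 by norm_num) (show (-1.1 : ℝ)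 ≤ -0.1 by norm_num) (show (-0.1 : ℝ) < 0 by norm_num)).Dtmin - 2 * A))) + (1 + 1 : ℕ).factorial * (max (max K₀ K₁) (max K₂ K₃)) * max (1 / ((bandBounds (show (-4 : ℝ) < -1.1 by norm_num) (show (-1.1 : ℝ) ≤ -0.1 by norm_num) (show (-0.1 : ℝ) < 0 by norm_num)).Dtmin - 2 * A)) (radialRowOneConst A ((bandBounds (show (-4 : ℝ) < -1.1 by norm_num) (show (-1.1 : ℝ) ≤ -0.1 by norm_num) (show (-0.1 : ℝ) < 0 by norm_num)).Dtmin - 2 * A)) * (max 1 (3 * msD A₃ A₄ 1 + r * radialRowOneConst A ((bandBounds (show (-4 : ℝ) < -1.1 by norm_num) (show (-1.1 : ℝ) ≤ -0.1 by norm_num) (show (-0.1 : ℝ) < 0 by norm_num)).Dtmin - 2 * A))) ^ 1) + ((6 * (max (max K₀ K₁) (max K₂ K₃)) * (max 1 (max (4 * msD A₃ A₄ 1) (max (6 * msD A₃ A₄ 2) (10 * msD A₃ A₄ 3)))) ^ 3) / (2 * (3 / 400 * (bandBounds (show (-4 : ℝ) < -1.1 by norm_num) (show (-1.1 : ℝ)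 ≤ -0.1 by norm_num) (show (-0.1 : ℝ) < 0 by norm_num)).umin ^ 2)) * ((max (max K₀ K₁) (max K₂ K₃)) * max (1 / ((bandBounds (show (-4 : ℝ) < -1.1 by norm_num) (show (-1.1 : ℝ) ≤ -0.1 by norm_num) (show (-0.1 : ℝ) < 0 by norm_num)).Dtmin - 2 * A)) (radialRowOneConst A ((bandBounds (show (-4 : ℝ) < -1.1 by norm_num) (show (-1.1 : ℝ) ≤ -0.1 by norm_num) (show (-0.1 : ℝ) < 0 by norm_num)).Dtmin - 2 * A))) + (1 + 1 : ℕ).factorial * (max (max K₀ K₁) (max K₂ K₃)) * max (1 / ((bandBounds (show (-4 : ℝ) < -1.1 by norm_num) (show (-1.1 : ℝ) ≤ -0.1 by norm_num) (show (-0.1 : ℝ) < 0 by norm_num)).Dtmin - 2 * A)) (radialRowOneConst A ((bandBounds (show (-4 : ℝ) < -1.1 by norm_num) (show (-1.1 : ℝ) ≤ -0.1 by norm_num) (show (-0.1 : ℝ) < 0 by norm_num)).Dtmin - 2 * A)) * (max 1 (3 * msD A₃ A₄ 1 + r * radialRowOneConst A ((bandBounds (show (-4 : ℝ) < -1.1 by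 norm_num) (show (-1.1 : ℝ) ≤ -0.1 by norm_num) (show (-0.1 : ℝ) < 0 by norm_num)).Dtmin - 2 * A))) ^ 1) * (|ρ| / lo)) + (24 * msD A₃ A₄ 1 / τ₂ * J₀ + J₁)) *
        (2 * (2 * π * (Kd + P * (1 + log⁺ (M / π)))) + 2 * π * (4 * π * Wt)) +
        (J₀ * (max ((K₂ * msD A₃ A₄ 1 * msD A₃ A₄ 2 + (K₃ * msD A₃ A₄ 1 ^ 2 + K₂ * msD A₃ A₄ 2) * msD A₃ A₄ 1) /
            ((2 / π * (((bandBounds (show (-4 : ℝ) < -1.1 by norm_num) (show (-1.1 : ℝ) ≤ -0.1 by norm_num) (show (-0.1 : ℝ) < 0 by norm_num)).Dtmin - 2 * A) *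
        (bandBounds (show (-4 : ℝ) < -1.1 by norm_num) (show (-1.1 : ℝ) ≤ -0.1 by norm_num) (show (-0.1 : ℝ) < 0 by norm_num)).umin) *
        ((bandBounds (show (-4 : ℝ) < -1.1 by norm_num) (show (-1.1 : ℝ) ≤ -0.1 by norm_num) (show (-0.1 : ℝ) < 0 by norm_num)).umin * w / (4 + 2 * A))) / 2))
          ((K₁ * msD A₃ A₄ 2 + K₂ * msD A₃ A₄ 1 * msD A₃ A₄ 1) /
            ((2 / π * (((bandBounds (show (-4 : ℝ) < -1.1 by norm_num) (show (-1.1 : ℝ) ≤ -0.1 by norm_num) (show (-0.1 : ℝ) < 0 by norm_num)).Dtmin - 2 * A) *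
        (bandBounds (show (-4 : ℝ) < -1.1 by norm_num) (show (-1.1 : ℝ) ≤ -0.1 by norm_num) (show (-0.1 : ℝ) < 0 by norm_num)).umin) *
        ((bandBounds (show (-4 : ℝ) < -1.1 by norm_num) (show (-1.1 : ℝ) ≤ -0.1 by norm_num) (show (-0.1 : ℝ) < 0 by norm_num)).umin * w / (4 + 2 * A))) * δ₀ / 4)) +
        (max ((K₂ * msD A₃ A₄ 1 * msD A₃ A₄ 2 + (K₃ * msD A₃ A₄ 1 ^ 2 + K₂ * msD A₃ A₄ 2) * msD A₃ A₄ 1) /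
            ((2 / π * (((bandBounds (show (-4 : ℝ) < -1.1 by norm_num) (show (-1.1 : ℝ) ≤ -0.1 by norm_num) (show (-0.1 : ℝ) < 0 by norm_num)).Dtmin - 2 * A) *
        (bandBounds (show (-4 : ℝ) < -1.1 by norm_num) (show (-1.1 : ℝ) ≤ -0.1 by norm_num) (show (-0.1 : ℝ) < 0 by norm_num)).umin) *
        ((bandBounds (show (-4 : ℝ) < -1.1 by norm_num) (show (-1.1 : ℝ) ≤ -0.1 by norm_num) (show (-0.1 : ℝ) < 0 by norm_num)).umin * w / (4 + 2 * A))) / 2))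
          ((K₁ * msD A₃ A₄ 2 + K₂ * msD A₃ A₄ 1 * msD A₃ A₄ 1) /
            ((2 / π * (((bandBounds (show (-4 : ℝ) < -1.1 by norm_num) (show (-1.1 : ℝ) ≤ -0.1 by norm_num) (show (-0.1 : ℝ) < 0 by norm_num)).Dtmin - 2 * A) *
        (bandBounds (show (-4 : ℝ) < -1.1 by norm_num) (show (-1.1 : ℝ) ≤ -0.1 by norm_num) (show (-0.1 : ℝ) < 0 by norm_num)).umin) *
        ((bandBounds (show (-4 : ℝ) < -1.1 by norm_num) (show (-1.1 : ℝ) ≤ -0.1 by norm_num) (show (-0.1 : ℝ) < 0 by norm_num)).umin * w / (4 + 2 * A))) * δ₀ / 4)) *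
          ((max K₁ K₂) * max (1 / ((bandBounds (show (-4 : ℝ) < -1.1 by norm_num) (show (-1.1 : ℝ) ≤ -0.1 by norm_num) (show (-0.1 : ℝ) < 0 by norm_num)).Dtmin - 2 * A))
            (radialRowOneConst A ((bandBounds (show (-4 : ℝ) < -1.1 by norm_num) (show (-1.1 : ℝ) ≤ -0.1 by norm_num) (show (-0.1 : ℝ) < 0 by norm_num)).Dtmin - 2 * A))) +
        2 * (max K₁ K₂) *
          max (1 / ((bandBounds (show (-4 : ℝ) < -1.1 by norm_num) (show (-1.1 : ℝ) ≤ -0.1 by norm_num) (show (-0.1 : ℝ) < 0 by norm_num)).Dtmin - 2 * A))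
            (radialRowOneConst A ((bandBounds (show (-4 : ℝ) < -1.1 by norm_num) (show (-1.1 : ℝ) ≤ -0.1 by norm_num) (show (-0.1 : ℝ) < 0 by norm_num)).Dtmin - 2 * A)) *
          (max 1 (3 * msD A₃ A₄ 1 + r * radialRowOneConst A ((bandBounds (show (-4 : ℝ) < -1.1 by norm_num) (show (-1.1 : ℝ) ≤ -0.1 by norm_num) (show (-0.1 : ℝ) < 0 by norm_num)).Dtmin - 2 * A)))) +
        (max ((K₂ * msD A₃ A₄ 1 * msD A₃ A₄ 2 + (K₃ * msD A₃ A₄ 1 ^ 2 + K₂ * msD A₃ A₄ 2) * msD A₃ A₄ 1) /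
            ((2 / π * (((bandBounds (show (-4 : ℝ) < -1.1 by norm_num) (show (-1.1 : ℝ) ≤ -0.1 by norm_num) (show (-0.1 : ℝ) < 0 by norm_num)).Dtmin - 2 * A) *
        (bandBounds (show (-4 : ℝ) < -1.1 by norm_num) (show (-1.1 : ℝ) ≤ -0.1 by norm_num) (show (-0.1 : ℝ) < 0 by norm_num)).umin) *
        ((bandBounds (show (-4 : ℝ) < -1.1 by norm_num) (show (-1.1 : ℝ) ≤ -0.1 by norm_num) (show (-0.1 : ℝ) < 0 by norm_num)).umin * w / (4 + 2 * A))) / 2))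
          ((K₁ * msD A₃ A₄ 2 + K₂ * msD A₃ A₄ 1 * msD A₃ A₄ 1) /
            ((2 / π * (((bandBounds (show (-4 : ℝ) < -1.1 by norm_num) (show (-1.1 : ℝ) ≤ -0.1 by norm_num) (show (-0.1 : ℝ) < 0 by norm_num)).Dtmin - 2 * A) *
        (bandBounds (show (-4 : ℝ) < -1.1 by norm_num) (show (-1.1 : ℝ) ≤ -0.1 by norm_num) (show (-0.1 : ℝ) < 0 by norm_num)).umin) *
        ((bandBounds (show (-4 : ℝ) < -1.1 by norm_num) (show (-1.1 : ℝ) ≤ -0.1 by norm_num) (show (-0.1 : ℝ) < 0 by norm_num)).umin * w / (4 + 2 * A))) * δ₀ / 4)) *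
          ((max K₁ K₂) * max (1 / ((bandBounds (show (-4 : ℝ) < -1.1 by norm_num) (show (-1.1 : ℝ) ≤ -0.1 by norm_num) (show (-0.1 : ℝ) < 0 by norm_num)).Dtmin - 2 * A))
            (radialRowOneConst A ((bandBounds (show (-4 : ℝ) < -1.1 by norm_num) (show (-1.1 : ℝ) ≤ -0.1 by norm_num) (show (-0.1 : ℝ) < 0 by norm_num)).Dtmin - 2 * A))) +
        2 * (max K₁ K₂) *
          max (1 / ((bandBounds (show (-4 : ℝ) < -1.1 by norm_num) (show (-1.1 : ℝ) ≤ -0.1 by norm_num) (show (-0.1 : ℝ) < 0 by norm_num)).Dtmin - 2 * A))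
            (radialRowOneConst A ((bandBounds (show (-4 : ℝ) < -1.1 by norm_num) (show (-1.1 : ℝ) ≤ -0.1 by norm_num) (show (-0.1 : ℝ) < 0 by norm_num)).Dtmin - 2 * A)) *
          (max 1 (3 * msD A₃ A₄ 1 + r * radialRowOneConst A ((bandBounds (show (-4 : ℝ) < -1.1 by norm_num) (show (-1.1 : ℝ) ≤ -0.1 by norm_num) (show (-0.1 : ℝ) < 0 by norm_num)).Dtmin - 2 * A)))) * (|ρ| / lo)) + (24 * msD A₃ A₄ 1 / τ₂ * J₀ + J₁)) *
        (2 * (2 * π * (Kd + P * (1 + log⁺ (M / π)))) + 2 * π * (4 * π * Wt)) := by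
  have hπ := Real.pi_pos
  have hhi0 : 0 < hi := hlo0.trans_le hlohi
  -- the three cut-off numerators
  set cd : ℝ → ℝ → ℝ := umkDirCut μ K ρ θ τ₂ with hcd
  set cc : ℝ → ℝ := umkCooperCut μ K ρ θ s₂ with hcc
  set cT : ℝ → ℝ → ℝ := fun ϑ v => 1 - cd ϑ v with hcT
  set cC : ℝ → ℝ → ℝ := fun ϑ v => cd ϑ v * (1 - cc ϑ) with hcC
  set Gf : ℝ → ℝ → ℝ → ℝ := fun ϑ e v => (fderiv ℝ (frameLevel μ K) (pairSumPath μ K ρ ϑ θ 0 - levelPoint μ K e (v + θ)))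
    (iteratedDeriv 1 (levelPoint μ K 0) θ + iteratedDeriv 1 (levelPoint μ K ρ) (ϑ + θ)) with hGf
  set Kp : ℝ → ℝ → ℝ → ℝ := fun ϑ e v => deriv (Kr e) (frameLevel μ K (pairSumPath μ K ρ ϑ θ 0 - levelPoint μ K e (v + θ))) with hKp
  -- rows of the cut-offs
  have hcd01 : ∀ ϑ v, cd ϑ v ∈ Icc (0 : ℝ) 1 := fun ϑ v => umkDirCut_mem_Icc μ K ρ θ τ₂ ϑ v
  have hcc01 : ∀ ϑ, cc ϑ ∈ Icc (0 : ℝ) 1 := fun ϑ => umkCooperCut_mem_Icc μ K ρ θ s₂ ϑ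
  have hcdD : ∀ ϑ, ContDiff ℝ 1 (cd ϑ) := fun ϑ => contDiff_umkDirCut hA hd hr hlo hhi ρ θ τ₂ ϑ
  have hcdper : ∀ ϑ v, cd ϑ (v + 2 * π) = cd ϑ v := fun ϑ v => umkDirCut_periodic μ K ρ θ τ₂ ϑ v
  have hcd1 : ∀ ϑ v, |deriv (cd ϑ) v| ≤ 24 * msD A₃ A₄ 1 / τ₂ := fun ϑ v => abs_deriv_umkDirCut_le hA hA20 hd hr hlo hhi hA₃ hA₄ hτ₂ ρ θ ϑ v
  have hcd2 : Continuous fun q : ℝ × ℝ => cd q.1 q.2 := continuous_umkDirCut₂ hA hd hr hlo hhi hρ θ τ₂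
  have hcc2 : Continuous cc := continuous_umkCooperCut hA hd hlo hhi hρ θ s₂
  -- rows of `cT = 1 − c_d`
  have hcTD : ∀ ϑ, ContDiff ℝ 1 (cT ϑ) := fun ϑ => contDiff_const.sub (hcdD ϑ)
  have hcTb : ∀ ϑ v, |cT ϑ v| ≤ 1 := fun ϑ v => by
    have h := hcd01 ϑ v; rw [abs_le]; constructor <;> simp only [hcT] <;> linarith [h.1, h.2]
  have hcT1 : ∀ ϑ v, |deriv (cT ϑ) v| ≤ 24 * msD A₃ A₄ 1 / τ₂ := fun ϑ v => by
    have hdv : deriv (cT ϑ) v = -deriv (cd ϑ) v := by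
      simp only [hcT]; rw [deriv_const_sub]
    rw [hdv, abs_neg]; exact hcd1 ϑ v
  have hcTper : ∀ ϑ v, cT ϑ (v + 2 * π) = cT ϑ v := fun ϑ v => by simp only [hcT, hcdper]
  have hcTsupp : ∀ ϑ v, τ₂ ≤ ‖pairSumPath μ K ρ ϑ θ 0 - (2 : ℝ) • levelPoint μ K 0 (v + θ)‖ → cT ϑ v = 0 := fun ϑ v h => by
    simp only [hcT, hcd, umkDirCut_eq_one hτ₂ μ K ρ θ ϑ v h, sub_self]
  -- rows of `cC = c_d (1 − c_C)`
  have hcCD : ∀ ϑ, ContDiff ℝ 1 (cC ϑ) := fun ϑ => (hcdD ϑ).mul contDiff_const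
  have hcCb : ∀ ϑ v, |cC ϑ v| ≤ 1 := fun ϑ v => by
    have h1 := hcd01 ϑ v; have h2 := hcc01 ϑ
    simp only [hcC]; rw [abs_mul, abs_of_nonneg h1.1, abs_of_nonneg (by linarith [h2.2] : (0:ℝ) ≤ 1 - cc ϑ)]
    nlinarith [h1.1, h1.2, h2.1, h2.2]
  have hcC1 : ∀ ϑ v, |deriv (cC ϑ) v| ≤ 24 * msD A₃ A₄ 1 / τ₂ := fun ϑ v => by
    have hdv : deriv (cC ϑ) v = deriv (cd ϑ) v * (1 - cc ϑ) := by
      simp only [hcC]; rw [deriv_mul_const (((hcdD ϑ).differentiable one_ne_zero) v)]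
    have h2 := hcc01 ϑ
    rw [hdv, abs_mul, abs_of_nonneg (by linarith [h2.2] : (0:ℝ) ≤ 1 - cc ϑ)]
    calc |deriv (cd ϑ) v| * (1 - cc ϑ) ≤ 24 * msD A₃ A₄ 1 / τ₂ * 1 :=
          mul_le_mul (hcd1 ϑ v) (by linarith [h2.1]) (by linarith [h2.2]) (by have := msD_one_pos A₃ A₄; positivity)
      _ = 24 * msD A₃ A₄ 1 / τ₂ := mul_one _
  have hcCper : ∀ ϑ v, cC ϑ (v + 2 * π) = cC ϑ v := fun ϑ v => by simp only [hcC, hcdper]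
  have hcCsupp : ∀ ϑ v, s₂ < ‖pairSumPath μ K ρ ϑ θ 0‖ → cC ϑ v = 0 := fun ϑ v h => by
    simp only [hcC, hcc, umkCooperCut_eq_one hs₂ μ K ρ θ ϑ h.le, sub_self, mul_zero]
  -- §1 the two direct parts
  have hT := directTangency_layers_abs_le' hA hA20 hd hr hlo hhi hA₃ hA₄ hA₅ hA₆ hK₁ hK₂ hK₃ hF hG hW hK₀ hρ θ hκ0 hκ hWϑ0 hWϑ hmargin hvW hP hWt hdom hlo0 hlohi
    hhi₀ hhir hwc hw0 hwW (c := cT) (J := Jw) (Kr := Kr) hcTD hcTb hcT1 hcTper hcTsupp hJ hJb hJ1 hJper hKd hK0 hK0s hK1 hKs1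
  have hC := directCooper_layers_abs_le hA hA20 hd hr hlo hhi hA₃ hA₄ hA₅ hA₆ hK₁ hK₂ hK₃ hG hδ₀ hδ₀π hδrow hη₀ hη₀row hs₂η θ hρ hP hWt hdom hlo0 hlohi
    hhi₀ hhir hwc hw0 hwW (c := cC) (J := Jw) (Kr := Kr) hcCD hcCb hcC1 hcCper hcCsupp hJ hJb hJ1 hJper hKd hK0 hK0s hK1 hKs1
  -- §2 the three box integrals are continuous in ϑ
  have hX3U : ContinuousOn (fun p : ℝ × ℝ × ℝ => cd p.1 p.2.2 * cc p.1 * Jw p.2.1 p.2.2 * Gf p.1 p.2.1 p.2.2) (univ ×ˢ (Icc (-hi) hi ×ˢ univ)) :=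
    umkNumerator_continuousOn₃ hA hd hlo hhi hρ θ hhir hcd2 hcc2 hJ2
  have hX3T : ContinuousOn (fun p : ℝ × ℝ × ℝ => cT p.1 p.2.2 * Jw p.2.1 p.2.2 * Gf p.1 p.2.1 p.2.2) (univ ×ˢ (Icc (-hi) hi ×ˢ univ)) := by
    have h := umkNumerator_continuousOn₃ hA hd hlo hhi hρ θ hhir (cd := cT) (cc := fun _ => (1 : ℝ)) (Jw := Jw)
      (continuous_const.sub hcd2) continuous_const hJ2
    exact h.congr fun p _ => by simp only [hGf, mul_one]
  have hX3C : ContinuousOn (fun p : ℝ × ℝ × ℝ => cC p.1 p.2.2 * Jw p.2.1 p.2.2 * Gf p.1 p.2.1 p.2.2) (univ ×ˢ (Icc (-hi) hi ×ˢ univ)) := by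
    have h := umkNumerator_continuousOn₃ hA hd hlo hhi hρ θ hhir (cd := cd) (cc := fun ϑ => 1 - cc ϑ) (Jw := Jw)
      hcd2 (continuous_const.sub hcc2) hJ2
    exact h.congr fun p _ => by simp only [hcC, hGf]
  -- the three pieces as functions of ϑ
  set FU : ℝ → ℝ := fun ϑ => ∫ e in (-hi)..hi, wt e * ∫ v in (-π)..π, (cd ϑ v * cc ϑ * Jw e v * Gf ϑ e v) * Kp ϑ e v with hFU
  set FT : ℝ → ℝ := fun ϑ => ∫ e in (-hi)..hi, wt e * ∫ v in (-π)..π, cT ϑ v * Jw e v * (Gf ϑ e v * Kp ϑ e v) with hFT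
  set FC : ℝ → ℝ := fun ϑ => ∫ e in (-hi)..hi, wt e * ∫ v in (-π)..π, cC ϑ v * Jw e v * (Gf ϑ e v * Kp ϑ e v) with hFC
  have hcontU : Continuous FU := by
    have h := continuous_boxIntegral_cfg hA hd hlo hhi hρ θ (φa := -π) (φb := π) hhi0.le hhir (Kr := Kr)
      (X := fun ϑ e v => cd ϑ v * cc ϑ * Jw e v * Gf ϑ e v) hX3U hKc hwc
    refine h.congr fun ϑ => ?_
    simp only [hFU]
    refine intervalIntegral.integral_congr fun e _ => ?_
    rw [← intervalIntegral.integral_const_mul]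
  have hcontT : Continuous FT := by
    have h := continuous_boxIntegral_cfg hA hd hlo hhi hρ θ (φa := -π) (φb := π) hhi0.le hhir (Kr := Kr)
      (X := fun ϑ e v => cT ϑ v * Jw e v * Gf ϑ e v) hX3T hKc hwc
    refine h.congr fun ϑ => ?_
    simp only [hFT]
    refine intervalIntegral.integral_congr fun e _ => ?_
    rw [← intervalIntegral.integral_const_mul]
    refine intervalIntegral.integral_congr fun v _ => ?_
    ring
  have hcontC : Continuous FC := by
    have h := continuous_boxIntegral_cfg hA hd hlo hhi hρ θ (φa := -π) (φb := π) hhi0.le hhir (Kr := Kr)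
      (X := fun ϑ e v => cC ϑ v * Jw e v * Gf ϑ e v) hX3C hKc hwc
    refine h.congr fun ϑ => ?_
    simp only [hFC]
    refine intervalIntegral.integral_congr fun e _ => ?_
    rw [← intervalIntegral.integral_const_mul]
    refine intervalIntegral.integral_congr fun v _ => ?_
    ring
  -- §3 the pointwise split of the box integral
  have hsplit : ∀ ϑ, (∫ e in (-hi)..hi, wt e * ∫ v in (-π)..π, Jw e v * Gf ϑ e v * Kp ϑ e v) = FU ϑ + FT ϑ + FC ϑ := by
    intro ϑ
    -- per level: continuity in v of the three integrands
    have hX2U := continuousOn_slice_of_continuousOn₃ (hi := hi) (X := fun ϑ e v => cd ϑ v * cc ϑ * Jw e v * Gf ϑ e v) hX3U ϑ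
    have hX2T := continuousOn_slice_of_continuousOn₃ (hi := hi) (X := fun ϑ e v => cT ϑ v * Jw e v * Gf ϑ e v) hX3T ϑ
    have hX2C := continuousOn_slice_of_continuousOn₃ (hi := hi) (X := fun ϑ e v => cC ϑ v * Jw e v * Gf ϑ e v) hX3C ϑ
    have hIU := continuousOn_level_lineIntegral hA hd hlo hhi (ρ := ρ) ϑ θ hhi0.le hhir (X := fun ϑ e v => cd ϑ v * cc ϑ * Jw e v * Gf ϑ e v) (Kr := Kr) hX2U hKc
    have hIT := continuousOn_level_lineIntegral hA hd hlo hhi (ρ := ρ) ϑ θ hhi0.le hhir (X := fun ϑ e v => cT ϑ v * Jw e v * Gf ϑ e v) (Kr := Kr) hX2T hKc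
    have hIC := continuousOn_level_lineIntegral hA hd hlo hhi (ρ := ρ) ϑ θ hhi0.le hhir (X := fun ϑ e v => cC ϑ v * Jw e v * Gf ϑ e v) (Kr := Kr) hX2C hKc
    have hiU : IntervalIntegrable (fun e => wt e * ∫ v in (-π)..π, cd ϑ v * cc ϑ * Jw e v * Gf ϑ e v * Kp ϑ e v) volume (-hi) hi := by
      refine ContinuousOn.intervalIntegrable ?_
      rw [uIcc_of_le (by linarith)]; exact hwc.mul hIU
    have hiT : IntervalIntegrable (fun e => wt e * ∫ v in (-π)..π, cT ϑ v * Jw e v * Gf ϑ e v * Kp ϑ e v) volume (-hi) hi := by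
      refine ContinuousOn.intervalIntegrable ?_
      rw [uIcc_of_le (by linarith)]; exact hwc.mul hIT
    have hiC : IntervalIntegrable (fun e => wt e * ∫ v in (-π)..π, cC ϑ v * Jw e v * Gf ϑ e v * Kp ϑ e v) volume (-hi) hi := by
      refine ContinuousOn.intervalIntegrable ?_
      rw [uIcc_of_le (by linarith)]; exact hwc.mul hIC
    have hiT' : IntervalIntegrable (fun e => wt e * ∫ v in (-π)..π, cT ϑ v * Jw e v * (Gf ϑ e v * Kp ϑ e v)) volume (-hi) hi := by
      refine hiT.congr fun e _ => ?_
      congr 1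
      exact intervalIntegral.integral_congr fun v _ => by ring
    have hiC' : IntervalIntegrable (fun e => wt e * ∫ v in (-π)..π, cC ϑ v * Jw e v * (Gf ϑ e v * Kp ϑ e v)) volume (-hi) hi := by
      refine hiC.congr fun e _ => ?_
      congr 1
      exact intervalIntegral.integral_congr fun v _ => by ring
    have hiUT : IntervalIntegrable (fun e => (wt e * ∫ v in (-π)..π, cd ϑ v * cc ϑ * Jw e v * Gf ϑ e v * Kp ϑ e v) +
        (wt e * ∫ v in (-π)..π, cT ϑ v * Jw e v * (Gf ϑ e v * Kp ϑ e v))) volume (-hi) hi := hiU.add hiT'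
    have hlev : ∀ e ∈ Icc (-hi) hi, (∫ v in (-π)..π, Jw e v * Gf ϑ e v * Kp ϑ e v) =
        (∫ v in (-π)..π, cd ϑ v * cc ϑ * Jw e v * Gf ϑ e v * Kp ϑ e v) + (∫ v in (-π)..π, cT ϑ v * Jw e v * (Gf ϑ e v * Kp ϑ e v)) +
          ∫ v in (-π)..π, cC ϑ v * Jw e v * (Gf ϑ e v * Kp ϑ e v) := by
      intro e he
      have her : |e| < r := lt_of_le_of_lt (abs_le.2 ⟨he.1, he.2⟩) hhir
      -- continuity in v of each integrand on the line
      have hlineU : Continuous fun v => cd ϑ v * cc ϑ * Jw e v * Gf ϑ e v * Kp ϑ e v := by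
        have h1 := hX2U.comp_continuous (f := fun v : ℝ => ((e, v) : ℝ × ℝ)) (continuous_const.prodMk continuous_id) fun v => mem_prod.2 ⟨he, mem_univ _⟩
        have h2 : Continuous fun v : ℝ => Kp ϑ e v :=
          (hKc.comp (continuous_const.prodMk ((contDiff_partnerBand_pp_angle hA hd hlo hhi ρ her ϑ θ 0).continuous))).congr fun _ => rfl
        exact (h1.congr fun _ => rfl).mul h2
      have hlineT : Continuous fun v => cT ϑ v * Jw e v * (Gf ϑ e v * Kp ϑ e v) := by
        have h1 := hX2T.comp_continuous (f := fun v : ℝ => ((e, v) : ℝ × ℝ)) (continuous_const.prodMk continuous_id) fun v => mem_prod.2 ⟨he, mem_univ _⟩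
        have h2 : Continuous fun v : ℝ => Kp ϑ e v :=
          (hKc.comp (continuous_const.prodMk ((contDiff_partnerBand_pp_angle hA hd hlo hhi ρ her ϑ θ 0).continuous))).congr fun _ => rfl
        exact (h1.mul h2).congr fun _ => by simp only [Pi.mul_apply, Function.comp_apply]; ring
      have hlineC : Continuous fun v => cC ϑ v * Jw e v * (Gf ϑ e v * Kp ϑ e v) := by
        have h1 := hX2C.comp_continuous (f := fun v : ℝ => ((e, v) : ℝ × ℝ)) (continuous_const.prodMk continuous_id) fun v => mem_prod.2 ⟨he, mem_univ _⟩
        have h2 : Continuous fun v : ℝ => Kp ϑ e v :=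
          (hKc.comp (continuous_const.prodMk ((contDiff_partnerBand_pp_angle hA hd hlo hhi ρ her ϑ θ 0).continuous))).congr fun _ => rfl
        exact (h1.mul h2).congr fun _ => by simp only [Pi.mul_apply, Function.comp_apply]; ring
      have hlineUT : Continuous fun v => cd ϑ v * cc ϑ * Jw e v * Gf ϑ e v * Kp ϑ e v + cT ϑ v * Jw e v * (Gf ϑ e v * Kp ϑ e v) :=
        hlineU.add hlineT
      rw [← intervalIntegral.integral_add (hlineU.intervalIntegrable _ _) (hlineT.intervalIntegrable _ _),
        ← intervalIntegral.integral_add (hlineUT.intervalIntegrable _ _) (hlineC.intervalIntegrable _ _)]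
      refine intervalIntegral.integral_congr fun v _ => ?_
      simp only [hcT, hcC]; ring
    have hlev' : (∫ e in (-hi)..hi, wt e * ∫ v in (-π)..π, Jw e v * Gf ϑ e v * Kp ϑ e v) =
        ∫ e in (-hi)..hi, (wt e * ∫ v in (-π)..π, cd ϑ v * cc ϑ * Jw e v * Gf ϑ e v * Kp ϑ e v) +
          (wt e * ∫ v in (-π)..π, cT ϑ v * Jw e v * (Gf ϑ e v * Kp ϑ e v)) + (wt e * ∫ v in (-π)..π, cC ϑ v * Jw e v * (Gf ϑ e v * Kp ϑ e v)) := by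
      refine intervalIntegral.integral_congr fun e he => ?_
      rw [uIcc_of_le (by linarith)] at he
      rw [hlev e he]; ring
    rw [hlev', intervalIntegral.integral_add hiUT hiC', intervalIntegral.integral_add hiU hiT']
  -- §4 the umklapp piece in the set-integral currency
  have hU' : ∫ ϑ in Ioc 0 (2 * π), |FU ϑ| ≤ U := by
    have h := hUmk
    rw [intervalIntegral.integral_of_le (by linarith)] at h
    refine le_trans (le_of_eq (setIntegral_congr_fun measurableSet_Ioc fun ϑ _ => ?_)) h
    simp only [hFU]
    congr 1
    refine intervalIntegral.integral_congr fun e _ => ?_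
    rw [← intervalIntegral.integral_const_mul]
  -- §5 assemble
  have hiFU : IntegrableOn (fun ϑ => |FU ϑ|) (Ioc 0 (2 * π)) := (hcontU.abs.integrableOn_Icc).mono_set Ioc_subset_Icc_self
  have hiFT : IntegrableOn (fun ϑ => |FT ϑ|) (Ioc 0 (2 * π)) := (hcontT.abs.integrableOn_Icc).mono_set Ioc_subset_Icc_self
  have hiFC : IntegrableOn (fun ϑ => |FC ϑ|) (Ioc 0 (2 * π)) := (hcontC.abs.integrableOn_Icc).mono_set Ioc_subset_Icc_self
  have hmono : ∫ ϑ in Ioc 0 (2 * π), |∫ e in (-hi)..hi, wt e * ∫ v in (-π)..π, Jw e v * Gf ϑ e v * Kp ϑ e v| ≤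
      ∫ ϑ in Ioc 0 (2 * π), (|FU ϑ| + |FT ϑ| + |FC ϑ|) := by
    have hiAll : IntegrableOn (fun ϑ => |FU ϑ| + |FT ϑ| + |FC ϑ|) (Ioc 0 (2 * π)) := (hiFU.add hiFT).add hiFC
    refine integral_mono_of_nonneg (Eventually.of_forall fun ϑ => abs_nonneg _) hiAll (Eventually.of_forall fun ϑ => ?_)
    simp only
    rw [hsplit ϑ]
    exact (abs_add_le _ _).trans (add_le_add (abs_add_le _ _) le_rfl)
  refine hmono.trans ?_
  have hiUT : IntegrableOn (fun ϑ => |FU ϑ| + |FT ϑ|) (Ioc 0 (2 * π)) := hiFU.add hiFT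
  rw [integral_add hiUT hiFC, integral_add hiFU hiFT]
  exact add_le_add (add_le_add hU' hT) hC

end Sizes

end Summit.HubbardSuperconductivity.HubbardSuperconductivity.Theorems.C4a

end
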